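import Summits.AtomisticToContinuum.Crystallization.Theorems.FrustratedLawDichotomyStrainedPatchChartFamiliesBent

/-!
# The AUGMENTED (Lagrangian) envelope: a non-box certificate architecture for the texture relief, typed into the (F1)/(F2)/(F3) engine («AugmentedEnvelope», lens-5 g60)

Lens-5 («finite / base range + asymptotic regime + bridge») node on the 27623 T-side piece `StrainedPatchRec`, target of record
`CoreOffTubeFloor (63/10) (63/10) (24/5) (1/100) 0` **[CORE-FAR]** (critic rows 1063 / 1066 / 1073).

PILOT VERDICT that motivates it (critic ROW 1073 (3), memo `NODE-g60.md` §1, numbers `pilot60.py`): per-SITE box certificates of class floors are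
dead at every strain band — the first-order texture sensitivity of one site energy is `½Σ_k |W₄₅'(r_k)| ≈ 2.1–2.5`, so a box of texture width `w`
debits `≈ 2.3·w` sitewise against affine floors `2.3e-3` (edge, hcp) … `1.2e-2` (misfit `0.10`): failure widths `w* = 1.1e-3` (edge) and `5.0e-3` (deep
band), below every certified texture bound ((G1b): `≥ 4.7e-3` idealised, `≥ 2.3e-2` honest exterior).  So the line needs a NON-BOX argument (row 1073 (3)).

THE NON-BOX ARGUMENT (§1, abstract, PROVED): the AUGMENTED SCORE `S̃ = S − Σ_i μ_i·c_i` (multipliers `μ_i ≥ 0` times the admissibility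
constraints `c_i ≥ 0`: lower windows `η_i − 1/20`, force caps `σ₁² − ‖F_a‖²`) satisfies `S̃ ≤ S` on the admissible class BY SIGN (`lagrange_dominance`,
no linearisation of the feasible SET — this is what the LP/outer-polytope certificates of OUTER30 could not do soundly); a ROBUST QUADRATIC MINORANT of
`S̃` at a host `z₀` (1-D Taylor in each bond length with the stiffness floor `a_p = min W₄₅''` over the bond's tube — no box Hessian, no remainder
bootstrap) of the form `S̃ z₀ + ⟪g, w⟫ + (λ/2)‖w‖²`, `λ > 0`, then gives `S ≥ S̃ z₀ − ‖g‖²/(2λ)` on the admissible part of the tube WITHOUT ANY ROOM LAW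
(`quadModel_floor`, `certificate_schema`: completing the square).  The room law (E2)/(F2), the UNDECIDED load-bearing piece of g50–g52 that (G1b) priced
out of reach, is thereby replaced by the pure COVER statement.

THE TYPED NODE (§§2–3, in the tree's parametric engine `…ChartFamilies` §2): the envelope modulus `augModulus P R G` (`t ↦ P + R + G·t`: multiplier
PRICE `P(z₀)`, quadratic Lagrangian RELIEF `R(z₀) = ‖g‖²/(2λ)` on the capped part, RIM mass `G(z₀)`·fine deviation on the uncapped part), the constant
law `constLaw τ`, the cover `FamilyCover 𝓘 ρ ε η₂ τ := ∃ chart with coarse = fine = τ` (⟺ `FamilyRoom … (constLaw τ)` for `τ ≥ 0`), the host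
inequality `AugHostIneq 𝓘 φ τ P R G` (⟺ `FamilyCert 𝓘 φ (augModulus P R G) (constLaw τ)`), and the junctions
`FamilyEnvelope 𝓘 τ (augModulus P R G) → FamilyCover 𝓘 ρ ε η₂ τ → AugHostIneq 𝓘 φ τ P R G → SoftFarFloor … η₂ φ → CoreOffTubeFloor (63/10) (63/10) ρ ε φ`
and — the soft band being VACUOUS at `η₂ = 1/8` (`softFarFloor_eighth`) — the residual-free record
`AugEnvelope 𝓑 η₃ τ P R G → BentCover 𝓑 η₃ τ → AugHostFloor 𝓑 η₃ τ P R G → CoreOffTubeFloor (63/10) (63/10) (24/5) (1/100) 0`.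
Lean fixes no census number; no new axioms, no cite tokens, no instances / notation / options.
-/

namespace Summit.AtomisticToContinuum.Crystallization.Theorems.FrustratedLawDichotomyStrainedPatchAugmentedEnvelope

open Summit.AtomisticToContinuum.Crystallization.Theorems.FrustratedLawDichotomyPeriodicBlockFlags (goodAtScale_mono)

open scoped BigOperators Classical RealInnerProductSpace
open Summit.AtomisticToContinuum.Crystallization.Theorems.FrustratedLawDichotomyMotifLemmas
open Summit.AtomisticToContinuum.Crystallization.Theorems.FrustratedLawDichotomyAveragingCut
open Summit.AtomisticToContinuum.Crystallization.Theorems.FrustratedLawDichotomyStrainedPatchHomSplit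
open Summit.AtomisticToContinuum.Crystallization.Theorems.FrustratedLawDichotomyStrainedPatchCleanCollar
open Summit.AtomisticToContinuum.Crystallization.Theorems.FrustratedLawDichotomyStrainedPatchPhaseCut
open Summit.AtomisticToContinuum.Crystallization.Theorems.FrustratedLawDichotomyStrainedPatchCoreTube
open Summit.AtomisticToContinuum.Crystallization.Theorems.FrustratedLawDichotomyStrainedPatchCoreTubeRecord
open Summit.AtomisticToContinuum.Crystallization.Theorems.FrustratedLawDichotomyStrainedPatchStrainBands
open Summit.AtomisticToContinuum.Crystallization.Theorems.FrustratedLawDichotomyStrainedPatchChartFamilies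
open Summit.AtomisticToContinuum.Crystallization.Theorems.FrustratedLawDichotomyStrainedPatchChartFamiliesBent

/-! ## §1. The certificate schema, abstract and PROVED: Lagrangian dominance by sign + a coercive quadratic minorant ⟹ a floor, no room law -/

/-- **Lagrangian dominance by SIGN.**  For multipliers `μ i z ≥ 0` and constraints `c i z ≥ 0` (the admissible class), the augmented score
`S z − Σ μ·c` is below `S z`.  No linearisation of the feasible set enters. [folklore] -/
theorem lagrange_dominance {ι X : Type*} (s : Finset ι) (S : X → ℝ) (μ c : ι → X → ℝ) {z : X}
    (hμ : ∀ i ∈ s, 0 ≤ μ i z) (hc : ∀ i ∈ s, 0 ≤ c i z) : S z - ∑ i ∈ s, μ i z * c i z ≤ S z := by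
  have h : 0 ≤ ∑ i ∈ s, μ i z * c i z := Finset.sum_nonneg fun i hi => mul_nonneg (hμ i hi) (hc i hi)
  linarith

/-- **The quadratic model's floor (completing the square).**  `−‖g‖²/(2λ) ≤ ⟪g, w⟫ + (λ/2)‖w‖²` for `λ > 0` and EVERY `w`: a coercive model is bounded
below uniformly in the displacement — this is what makes a ROOM LAW unnecessary. [folklore] -/
theorem quadModel_floor {V : Type*} [NormedAddCommGroup V] [InnerProductSpace ℝ V] (g w : V) {lam : ℝ} (hlam : 0 < lam) :
    -(‖g‖ ^ 2 / (2 * lam)) ≤ ⟪g, w⟫ + lam / 2 * ‖w‖ ^ 2 := by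
  have h1 : -(‖g‖ * ‖w‖) ≤ ⟪g, w⟫ := by
    have h := abs_real_inner_le_norm g w
    rw [abs_le] at h
    exact h.1
  have h2 : ‖g‖ * ‖w‖ - lam / 2 * ‖w‖ ^ 2 ≤ ‖g‖ ^ 2 / (2 * lam) := by
    rw [le_div_iff₀ (by positivity)]
    nlinarith [sq_nonneg (lam * ‖w‖ - ‖g‖)]
  linarith

/-- ★ **THE CERTIFICATE SCHEMA.**  `A ⊆ T` (the admissible class inside the tube of the host `z₀`), `S̃ ≤ S` on `A` (Lagrangian dominance), and the
robust quadratic minorant `S̃ z₀ + ⟪g, w z⟫ + (λ/2)‖w z‖² ≤ S̃ z` on `T` with `λ > 0` give the floor `S̃ z₀ − ‖g‖²/(2λ) ≤ S z` on `A`. [folklore] -/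
theorem certificate_schema {X V : Type*} [NormedAddCommGroup V] [InnerProductSpace ℝ V] {A T : Set X} (hAT : A ⊆ T)
    (S Saug : X → ℝ) (z₀ : X) (w : X → V) (g : V) {lam : ℝ} (hlam : 0 < lam)
    (hdom : ∀ z ∈ A, Saug z ≤ S z) (hmin : ∀ z ∈ T, Saug z₀ + ⟪g, w z⟫ + lam / 2 * ‖w z‖ ^ 2 ≤ Saug z) :
    ∀ z ∈ A, Saug z₀ - ‖g‖ ^ 2 / (2 * lam) ≤ S z := by
  intro z hz
  have h := quadModel_floor g (w z) hlam
  linarith [hdom z hz, hmin z (hAT hz)]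

/-- The schema with an additional LINEAR rim term `−G·t` (uncapped sites, fine deviation `t`): floor `S̃ z₀ − ‖g‖²/(2λ) − G·t`. [folklore] -/
theorem certificate_schema_rim {X V : Type*} [NormedAddCommGroup V] [InnerProductSpace ℝ V] {A T : Set X} (hAT : A ⊆ T)
    (S Saug : X → ℝ) (z₀ : X) (w : X → V) (g : V) {lam G t : ℝ} (hlam : 0 < lam)
    (hdom : ∀ z ∈ A, Saug z ≤ S z) (hmin : ∀ z ∈ T, Saug z₀ + ⟪g, w z⟫ + lam / 2 * ‖w z‖ ^ 2 - G * t ≤ Saug z) :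
    ∀ z ∈ A, Saug z₀ - ‖g‖ ^ 2 / (2 * lam) - G * t ≤ S z := by
  intro z hz
  have h := quadModel_floor g (w z) hlam
  linarith [hdom z hz, hmin z (hAT hz)]

/-! ## §2. The instance in the parametric engine: the augmented modulus, the constant law, the cover, the host inequality -/

/-- **`augModulus P R G`** — the envelope modulus of the augmented certificate: `Φ(z₀)(t) = P(z₀) + R(z₀) + G(z₀)·t` (multiplier price + quadratic
Lagrangian relief on the capped part + rim mass × fine deviation on the uncapped part). -/
noncomputable def augModulus (P R G : (M₀ : ℕ) → (Fin M₀ → E3) → Fin M₀ → ℝ) : (M₀ : ℕ) → (Fin M₀ → E3) → Fin M₀ → ℝ → ℝ :=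
  fun M₀ z₀ c₀ t => P M₀ z₀ c₀ + R M₀ z₀ c₀ + G M₀ z₀ c₀ * t

/-- **`constLaw τ`** — the trivial room law: fine deviation = the coarse chart tolerance. -/
def constLaw (τ : ℝ) : (M₀ : ℕ) → (Fin M₀ → E3) → Fin M₀ → ℝ := fun _ _ _ => τ

/-- **`FamilyCover 𝓘 ρ ε η₂ τ` [GEOMETRIC — the COVER]** — every far-class record cluster with an `η₂`-good centre is, modulo a linear isometry, charted by
an instance of the family with coarse AND fine deviation `τ` on the `63/10`-ball: (F2) with the room law replaced by the chart tolerance itself. -/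
def FamilyCover (𝓘 : (M₀ : ℕ) → (Fin M₀ → E3) → Fin M₀ → Prop) (ρ ε η₂ τ : ℝ) : Prop :=
  ∀ (M : ℕ) (z : Fin M → E3) (c : Fin M), Admissible M z c → CleanBall (63 / 10) z c → MonoPhaseBall (63 / 10) z c → ¬NearHomIsoAt ρ ε z c →
    GoodAtScale η₂ (3 / 2) z c →
      ∃ (R : E3 ≃ₗᵢ[ℝ] E3) (M₀ : ℕ) (z₀ : Fin M₀ → E3) (c₀ : Fin M₀) (e : Fin M → Fin M₀), ChartBy 𝓘 τ τ (⇑R ∘ z) c z₀ c₀ e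

/-- **`AugHostIneq 𝓘 φ τ P R G` [CERTIFICATE over the host family]** — on every instance, `φ + P + R + G·τ ≤ S(z₀)`. -/
def AugHostIneq (𝓘 : (M₀ : ℕ) → (Fin M₀ → E3) → Fin M₀ → Prop) (φ τ : ℝ) (P R G : (M₀ : ℕ) → (Fin M₀ → E3) → Fin M₀ → ℝ) : Prop :=
  ∀ (M₀ : ℕ) (z₀ : Fin M₀ → E3) (c₀ : Fin M₀), 𝓘 M₀ z₀ c₀ →
    φ + (P M₀ z₀ c₀ + R M₀ z₀ c₀ + G M₀ z₀ c₀ * τ) ≤ ballAvg (9 / 5) z₀ (xRec M₀ z₀) c₀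

/-- The cover IS the room statement for the constant law (`τ ≥ 0`). [formal bookkeeping] -/
theorem familyRoom_const_of_cover {𝓘 : (M₀ : ℕ) → (Fin M₀ → E3) → Fin M₀ → Prop} {ρ ε η₂ τ : ℝ} (hτ : 0 ≤ τ)
    (h : FamilyCover 𝓘 ρ ε η₂ τ) : FamilyRoom 𝓘 ρ ε η₂ τ (constLaw τ) := by
  intro M z c hz hcl hm hn hg
  obtain ⟨R, M₀, z₀, c₀, e, hch⟩ := h M z c hz hcl hm hn hg
  exact ⟨R, M₀, z₀, c₀, e, hτ, hch⟩

/-- … and conversely. [formal bookkeeping] -/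
theorem familyCover_of_familyRoom_const {𝓘 : (M₀ : ℕ) → (Fin M₀ → E3) → Fin M₀ → Prop} {ρ ε η₂ τ : ℝ}
    (h : FamilyRoom 𝓘 ρ ε η₂ τ (constLaw τ)) : FamilyCover 𝓘 ρ ε η₂ τ := by
  intro M z c hz hcl hm hn hg
  obtain ⟨R, M₀, z₀, c₀, e, -, hch⟩ := h M z c hz hcl hm hn hg
  exact ⟨R, M₀, z₀, c₀, e, hch⟩

/-- `familyCover_iff_familyRoom_const` (docstring added by the landing lane; see the module docstring). [formal bookkeeping] -/
theorem familyCover_iff_familyRoom_const {𝓘 : (M₀ : ℕ) → (Fin M₀ → E3) → Fin M₀ → Prop} {ρ ε η₂ τ : ℝ} (hτ : 0 ≤ τ) :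
    FamilyCover 𝓘 ρ ε η₂ τ ↔ FamilyRoom 𝓘 ρ ε η₂ τ (constLaw τ) :=
  ⟨familyRoom_const_of_cover hτ, familyCover_of_familyRoom_const⟩

/-- The cover is the WEAKEST room statement: any room law bounded by the chart tolerance gives it. [folklore] -/
theorem familyCover_of_familyRoom_le {𝓘 : (M₀ : ℕ) → (Fin M₀ → E3) → Fin M₀ → Prop} {ρ ε η₂ τ : ℝ}
    {T : (M₀ : ℕ) → (Fin M₀ → E3) → Fin M₀ → ℝ} (hT : ∀ (M₀ : ℕ) (z₀ : Fin M₀ → E3) (c₀ : Fin M₀), T M₀ z₀ c₀ ≤ τ)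
    (h : FamilyRoom 𝓘 ρ ε η₂ τ T) : FamilyCover 𝓘 ρ ε η₂ τ := by
  intro M z c hz hcl hm hn hg
  obtain ⟨R, M₀, z₀, c₀, e, -, hch⟩ := h M z c hz hcl hm hn hg
  exact ⟨R, M₀, z₀, c₀, e, hch.mono_t (hT M₀ z₀ c₀)⟩

/-- The cover is MONOTONE in the family and ANTITONE in `η₂`, and survives shrinking the far class. [formal bookkeeping] -/
theorem FamilyCover.mono_family {𝓘 𝓘' : (M₀ : ℕ) → (Fin M₀ → E3) → Fin M₀ → Prop} {ρ ε η₂ τ : ℝ} (h : FamilyCover 𝓘 ρ ε η₂ τ)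
    (hle : FamilyLE 𝓘 𝓘') : FamilyCover 𝓘' ρ ε η₂ τ := by
  intro M z c hz hcl hm hn hg
  obtain ⟨R, M₀, z₀, c₀, e, hch⟩ := h M z c hz hcl hm hn hg
  exact ⟨R, M₀, z₀, c₀, e, hch.mono_family hle⟩

/-- `FamilyCover.anti` (docstring added by the landing lane; see the module docstring). [formal bookkeeping] -/
theorem FamilyCover.anti {𝓘 : (M₀ : ℕ) → (Fin M₀ → E3) → Fin M₀ → Prop} {ρ ε η₂ η₂' τ : ℝ} (h : FamilyCover 𝓘 ρ ε η₂' τ) (hle : η₂ ≤ η₂') :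
    FamilyCover 𝓘 ρ ε η₂ τ :=
  fun M z c hz hcl hm hn hg => h M z c hz hcl hm hn (goodAtScale_mono hle hg)

/-- `FamilyCert` for the augmented modulus at the constant law IS the host inequality. [formal bookkeeping] -/
theorem familyCert_aug_iff {𝓘 : (M₀ : ℕ) → (Fin M₀ → E3) → Fin M₀ → Prop} {φ τ : ℝ} {P R G : (M₀ : ℕ) → (Fin M₀ → E3) → Fin M₀ → ℝ} :
    FamilyCert 𝓘 φ (augModulus P R G) (constLaw τ) ↔ AugHostIneq 𝓘 φ τ P R G := by
  constructor
  · intro h M₀ z₀ c₀ hI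
    have h' := h M₀ z₀ c₀ hI
    simp only [augModulus, constLaw] at h'
    linarith
  · intro h M₀ z₀ c₀ hI
    have h' := h M₀ z₀ c₀ hI
    simp only [augModulus, constLaw]
    linarith

/-- The host inequality is antitone in the floor and in each debit. [formal bookkeeping] -/
theorem AugHostIneq.of_le {𝓘 : (M₀ : ℕ) → (Fin M₀ → E3) → Fin M₀ → Prop} {φ φ' τ : ℝ} {P R G : (M₀ : ℕ) → (Fin M₀ → E3) → Fin M₀ → ℝ}
    (h : AugHostIneq 𝓘 φ τ P R G) (hle : φ' ≤ φ) : AugHostIneq 𝓘 φ' τ P R G :=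
  fun M₀ z₀ c₀ hI => by have h' := h M₀ z₀ c₀ hI; linarith

/-- `AugHostIneq.anti_family` (docstring added by the landing lane; see the module docstring). [formal bookkeeping] -/
theorem AugHostIneq.anti_family {𝓘 𝓘' : (M₀ : ℕ) → (Fin M₀ → E3) → Fin M₀ → Prop} {φ τ : ℝ} {P R G : (M₀ : ℕ) → (Fin M₀ → E3) → Fin M₀ → ℝ}
    (h : AugHostIneq 𝓘' φ τ P R G) (hle : FamilyLE 𝓘 𝓘') : AugHostIneq 𝓘 φ τ P R G :=
  fun M₀ z₀ c₀ hI => h M₀ z₀ c₀ (hle M₀ z₀ c₀ hI)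

/-! ## §3. The junctions: general `(ρ, ε, η₂, φ)` with the soft residual; the record with the soft band vacuous at `η₂ = 1/8` -/

/-- ★★ GENERAL NODE: augmented envelope ∧ cover ∧ host inequality ⟹ the edge-band far floor; with the soft residual ⟹ `CoreOffTubeFloor (63/10) (63/10) ρ ε φ`.
(The tree's `edgeFar_of_family` / `coreOff_of_family_of_soft` at `Φ := augModulus P R G`, `T := constLaw τ`.) [folklore] -/
theorem edgeFar_of_augEnvelope_of_cover_of_hostIneq {𝓘 : (M₀ : ℕ) → (Fin M₀ → E3) → Fin M₀ → Prop} {ρ ε η₂ τ φ : ℝ}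
    {P R G : (M₀ : ℕ) → (Fin M₀ → E3) → Fin M₀ → ℝ} (hτ : 0 ≤ τ) (hE : FamilyEnvelope 𝓘 τ (augModulus P R G))
    (hC : FamilyCover 𝓘 ρ ε η₂ τ) (hH : AugHostIneq 𝓘 φ τ P R G) : EdgeFarFloor (63 / 10) (63 / 10) ρ ε η₂ φ :=
  edgeFar_of_family hE (familyRoom_const_of_cover hτ hC) (familyCert_aug_iff.2 hH)

/-- `coreOff_of_augEnvelope_of_cover_of_hostIneq_of_soft` (docstring added by the landing lane; see the module docstring). [formal bookkeeping] -/
theorem coreOff_of_augEnvelope_of_cover_of_hostIneq_of_soft {𝓘 : (M₀ : ℕ) → (Fin M₀ → E3) → Fin M₀ → Prop} {ρ ε η₂ τ φ : ℝ}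
    {P R G : (M₀ : ℕ) → (Fin M₀ → E3) → Fin M₀ → ℝ} (hτ : 0 ≤ τ) (hE : FamilyEnvelope 𝓘 τ (augModulus P R G))
    (hC : FamilyCover 𝓘 ρ ε η₂ τ) (hH : AugHostIneq 𝓘 φ τ P R G) (hS : SoftFarFloor (63 / 10) (63 / 10) ρ ε η₂ φ) :
    CoreOffTubeFloor (63 / 10) (63 / 10) ρ ε φ :=
  coreOff_of_family_of_soft hE (familyRoom_const_of_cover hτ hC) (familyCert_aug_iff.2 hH) hS

/-- ★★ RESIDUAL-FREE NODE at `η₂ = 1/8`: the soft band is vacuous (the centre of a clean ball is `1/8`-good), so the cover over ALL far clusters and the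
host inequality give the far floor with NO residual. [folklore] -/
theorem coreOff_of_augEnvelope_of_cover_eighth {𝓘 : (M₀ : ℕ) → (Fin M₀ → E3) → Fin M₀ → Prop} {ρ ε τ φ : ℝ}
    {P R G : (M₀ : ℕ) → (Fin M₀ → E3) → Fin M₀ → ℝ} (hτ : 0 ≤ τ) (hE : FamilyEnvelope 𝓘 τ (augModulus P R G))
    (hC : FamilyCover 𝓘 ρ ε (1 / 8) τ) (hH : AugHostIneq 𝓘 φ τ P R G) : CoreOffTubeFloor (63 / 10) (63 / 10) ρ ε φ :=
  coreOff_of_augEnvelope_of_cover_of_hostIneq_of_soft hτ hE hC hH (softFarFloor_eighth (by norm_num) _ _ _ _)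

/-! ### The record pieces (bent chart family `bentFamily 𝓑 η₃`; `ρ = 24/5`, `ε = 1/100`, `φ = 0`, soft band vacuous) -/

/-- **(AE) `AugEnvelope 𝓑 η₃ τ P R G` [ANALYTIC · CERT-candidate]** — the augmented envelope on the bent family: every admissible clean mono record cluster
`τ`-charted by a bent instance scores `≥ S(z₀) − P(z₀) − R(z₀) − G(z₀)·t`.  METHOD (memo §2): Lagrangian dominance by sign + the robust quadratic
minorant (`certificate_schema_rim`); per host ONE sparse positive-definiteness test and ONE linear solve. -/
def AugEnvelope (𝓑 : Set (E3 → E3)) (η₃ τ : ℝ) (P R G : (M₀ : ℕ) → (Fin M₀ → E3) → Fin M₀ → ℝ) : Prop :=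
  FamilyEnvelope (bentFamily 𝓑 η₃) τ (augModulus P R G)

/-- **(BC) `BentCover 𝓑 η₃ τ` [GEOMETRIC · UNDECIDED · INSTRUMENTABLE]** — every far-class record cluster (centre `1/8`-good: all of them) is `τ`-charted by a
bent instance: the pure cover, no room law. -/
def BentCover (𝓑 : Set (E3 → E3)) (η₃ τ : ℝ) : Prop :=
  FamilyCover (bentFamily 𝓑 η₃) (24 / 5) (1 / 100) (1 / 8) τ

/-- **(AH) `AugHostFloor 𝓑 η₃ τ P R G` [CERTIFICATE over the bent host family]** — `P + R + G·τ ≤ S(z₀)` on every bent instance. -/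
def AugHostFloor (𝓑 : Set (E3 → E3)) (η₃ τ : ℝ) (P R G : (M₀ : ℕ) → (Fin M₀ → E3) → Fin M₀ → ℝ) : Prop :=
  AugHostIneq (bentFamily 𝓑 η₃) 0 τ P R G

/-- ★★★ THE RECORD NODE of g60: `(AE) ∧ (BC) ∧ (AH) ⟹ CoreOffTubeFloor (63/10) (63/10) (24/5) (1/100) 0` — no residual (soft band vacuous at `1/8`). -/
theorem coreOff_record_of_augEnvelope_of_bentCover_of_hostFloor {𝓑 : Set (E3 → E3)} {η₃ τ : ℝ} (hτ : 0 ≤ τ)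
    {P R G : (M₀ : ℕ) → (Fin M₀ → E3) → Fin M₀ → ℝ} (hE : AugEnvelope 𝓑 η₃ τ P R G) (hC : BentCover 𝓑 η₃ τ)
    (hH : AugHostFloor 𝓑 η₃ τ P R G) : CoreOffTubeFloor (63 / 10) (63 / 10) (24 / 5) (1 / 100) 0 :=
  coreOff_of_augEnvelope_of_cover_eighth hτ hE hC hH

/-- ★ The record with the soft residual of record kept (`η₂ = 1/10`, for comparison with g50–g52): cover only over edge-band centres. -/
theorem coreOff_record_of_augEnvelope_of_cover_tenth_of_soft {𝓑 : Set (E3 → E3)} {η₃ τ : ℝ} (hτ : 0 ≤ τ)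
    {P R G : (M₀ : ℕ) → (Fin M₀ → E3) → Fin M₀ → ℝ} (hE : AugEnvelope 𝓑 η₃ τ P R G)
    (hC : FamilyCover (bentFamily 𝓑 η₃) (24 / 5) (1 / 100) (1 / 10) τ) (hH : AugHostFloor 𝓑 η₃ τ P R G)
    (hS : SoftFarFloor (63 / 10) (63 / 10) (24 / 5) (1 / 100) (1 / 10) 0) : CoreOffTubeFloor (63 / 10) (63 / 10) (24 / 5) (1 / 100) 0 :=
  coreOff_of_augEnvelope_of_cover_of_hostIneq_of_soft hτ hE hC hH hS

/-- ★ Threaded to the 27623 piece through the tree's record assembly (pieces of record as hypotheses, any residual floor dropped: `φ₁ = 0`). -/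
theorem strainedPatchRec_of_homFloor_625_of_aug {𝓑 : Set (E3 → E3)} {η₃ τ : ℝ} (hτ : 0 ≤ τ)
    {P R G : (M₀ : ℕ) → (Fin M₀ → E3) → Fin M₀ → ℝ}
    (hHF : HomFloor (1 / 625)) (hT : TailPenalty (24 / 5) (1 / 1000)) (hRl : CoreCoreRelief (63 / 10) (63 / 10) (24 / 5) (1 / 100) (3 / 5000))
    (hE : AugEnvelope 𝓑 η₃ τ P R G) (hC : BentCover 𝓑 η₃ τ) (hH : AugHostFloor 𝓑 η₃ τ P R G)
    (hF : AnnularPhaseFloor (63 / 10) (24 / 5) (63 / 10) (1 / 1000)) (hP : PolyTextureFloor (63 / 10) (24 / 5) (1 / 1000))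
    (hA : AnnularDefectFloor (24 / 5) (63 / 10)) (hD : DefectiveCollarFloor (24 / 5)) : StrainedPatchRec :=
  strainedPatchRec_of_homFloor_625_of_family_of_soft hHF hT hRl hE (familyRoom_const_of_cover hτ hC) (familyCert_aug_iff.2 hH)
    (softFarFloor_eighth (by norm_num) _ _ _ _) le_rfl hF hP hA hD

/-! ### Sanity: the trade-offs are the engine's (richer family ⟹ stronger envelope & host duty, easier cover) -/

/-- `AugEnvelope.anti_family` (docstring added by the landing lane; see the module docstring). [formal bookkeeping] -/
theorem AugEnvelope.anti_family {𝓑 𝓑' : Set (E3 → E3)} (hB : 𝓑 ⊆ 𝓑') {η₃ η₃' τ : ℝ} (hle : η₃ ≤ η₃')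
    {P R G : (M₀ : ℕ) → (Fin M₀ → E3) → Fin M₀ → ℝ} (h : AugEnvelope 𝓑' η₃' τ P R G) : AugEnvelope 𝓑 η₃ τ P R G :=
  FamilyEnvelope.anti_family h (bentFamily_le hB hle)

/-- `BentCover.mono_family` (docstring added by the landing lane; see the module docstring). [formal bookkeeping] -/
theorem BentCover.mono_family {𝓑 𝓑' : Set (E3 → E3)} (hB : 𝓑 ⊆ 𝓑') {η₃ η₃' τ : ℝ} (hle : η₃ ≤ η₃') (h : BentCover 𝓑 η₃ τ) :
    BentCover 𝓑' η₃' τ :=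
  FamilyCover.mono_family h (bentFamily_le hB hle)

/-- `AugHostFloor.anti_family` (docstring added by the landing lane; see the module docstring). [formal bookkeeping] -/
theorem AugHostFloor.anti_family {𝓑 𝓑' : Set (E3 → E3)} (hB : 𝓑 ⊆ 𝓑') {η₃ η₃' τ : ℝ} (hle : η₃ ≤ η₃')
    {P R G : (M₀ : ℕ) → (Fin M₀ → E3) → Fin M₀ → ℝ} (h : AugHostFloor 𝓑' η₃' τ P R G) : AugHostFloor 𝓑 η₃ τ P R G :=
  AugHostIneq.anti_family h (bentFamily_le hB hle)

end Summit.AtomisticToContinuum.Crystallization.Theorems.FrustratedLawDichotomyStrainedPatchAugmentedEnvelope
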